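import Summits.QuantumFields.BalabanUV.Beta.D1BFx.LocalGroupRowS
import Summits.QuantumFields.BalabanUV.Beta.D1BFx.RoadEndBFxRowsS
import Summits.QuantumFields.BalabanUV.Beta.D1BFx.NeedleRowsAtRayS
import Summits.QuantumFields.BalabanUV.Beta.D1BFx.NeedleGhostBubbleRowMass10
import Summits.QuantumFields.BalabanUV.Beta.D1BFx.NeedleGhostBubbleRowMass10T5
import Summits.QuantumFields.BalabanUV.Beta.D1BFx.NeedleGhostBubble2RowMass8
import Summits.QuantumFields.BalabanUV.Beta.D1BFx.GhostBubbleTailsII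
import Summits.QuantumFields.BalabanUV.Beta.D1BFx.RoadEndGroups

/-!
# `BalabanUV.Beta.D1BFx.RoadEndGroupsS` — road «BF-x» for binder row D1, slot (K), «END-WIRE-S»: THE GROUP HYPOTHESIS `hGrp` OF THE «ENDₛ» END UNDER READING (ii)
# (END-ii-SPEC v1.1 §3 (b)∕(c)) — the two-profile words `restKS (gfrz n a b) (s n • gfrz n a b)`, the RESCALED tie `ω_gh n·(s n·cK n)² = −2·ω_gl n·cE n²` with
# `s n = n⁻²`, and the WHOLE GHOST SECTOR SUPPLIED BY TREE THEOREMS: «L-GBUB» (`GhostBubbleTailsII.hGbub_s_of_prop12`), T₄∕T₅ (`NeedleGhostBubbleRowMass10{,T5}`),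
# T₆ (`NeedleGhostBubble2RowMass8`), T₇ (`NeedleGhostTadpoleRowMass8` via `NeedleRowsAtRayS`); REMAINING OPEN REST INPUT: the slot-4 tadpole row T₈ only

HONEST DEPENDENCY (cell records, verbatim): «continuum YM on T⁴ ⇐ BetaPertH ∧ nine spine estimates (0/9 proved); BetaPertH ⇐ (D1) ∧ (D4) ∧
CAP+tail; G-an2-4 gates asym, D1 and NE2/3/4.»  HONEST FRAMING (cell contract, verbatim): «discharging `BetaPertH` makes Bałaban's UV stability
UNCONDITIONAL — a real constructive-QFT result; it is NOT the continuum limit and NOT the Clay problem.»  THIS MODULE DISCHARGES NOTHING of the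
wall: [folklore] wiring BY NAME — `RoadEndBFxRowsS.hGrp_of_rowsS` fed with `LocalGroupRowS.hLoc_of_prop12'S` (its «L-GBUB» input from `GhostBubbleTailsII.hGbub_s_of_prop12`,
gan24-leaf-05-g44), `GluonNeedleRowsT12.h₁_of_prop12 ∕ h₂_of_prop12'`, `GluonNeedleRowT3.h₃_of_prop12''` (gluon rows of record — profile-free tables, unchanged), the tolerance
rows `h₄∕h₅_of_scaling₁₀` (leaf-01-g16), `h₆_of_scaling₈` (gan24-leaf-05-g44), `h₇_of_rayS` (leaf-04-g12's `h₇_of_scaling₈`) with their scaling letters from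
`NeedleRowsAtRayS`.  No `def`, no `def … : Prop`, nothing cited, 0 sorry; EVERY remaining input is a displayed HYPOTHESIS.  Root-level binders hW ∕ hR-sockets ∕
hSX-socket ∕ D1Tel ∕ D1Rep — 0 discharged; (K) NOT closed (T₈ + the letters listed); NOT D1, NOT `BetaPertH`, NOT continuum, NOT Clay.

ABSOLUTE RULE (cell charter, verbatim): «No internally-minted statement may enter as a cited fact. Every hypothesis is either kernel-proved in
this package or a verbatim quotation of a PUBLISHED theorem with page reference. The manuscript(s) under audit are NOT citable for their own
disputed steps — they are the thing under adjudication; programme-internal (2001/route/tribunal) claims are never citable.»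

WHY (owner ruling ρ-g11-9 «GHOST UNITS»: under the END of record's tie `hω` the ghost rows T₄–T₇ «met at the ray» and «L-GBUB» are VOID for Bałaban's kernels —
the tie is short of R-4(v) by `n⁴` against the typed ghost leg; reading (ii) = the rescaled tie with the ghost graded words at `n⁻²·gfrz`).  Under reading (ii) the
ghost letters are `n⁴` larger; an3-g65's census priced the re-counts (T₄∕T₅: needle thinness + the current's dipole, tolerance `n⁶ ↦ n¹⁰`; T₆: one placement per mixed
term, `n⁴ ↦ n⁸`; T₇: block-column mass, `n⁴ ↦ n⁸`; L-GBUB: the regraded split has the small grade-1 piece) and the swarm landed all four within the afternoon.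
THIS FILE wires them into the «ENDₛ» group hypothesis; `RoadEndBFxWiredS` then states the END.

CONTENT.
* [folklore] **`hGrp_of_prop12S`** — `∃ CGv : Fin 4 → ℝ, ∀ n ≥ 2, ∀ g ≠ 3, |Σ_{b ∈ image resSite} n⁻⁴·fullSum (w ↦ Σ_{τ : grpRec τ = g} restKS … τ w)| ≤ CGv g`.
Unit `b2b-balaban-beta-d1-p2` (gen 12), road «BF-x» OWNER; `LEAVES-BFx.md` row «END-WIRE-S»; END-ii-SPEC v1.1 §3 (b)∕(c).
-/

noncomputable section

open Finset Filter Topology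
open scoped BigOperators
open Literature.MathematicalPhysics.QuantumFieldTheory.Balaban1983to89
open Literature.MathematicalPhysics.QuantumFieldTheory.Balaban1983to89.Beta
open WindowIdentification (fullSum)
open B12Sec2to5 (l1)
open DyadicShell (Pt toReal supNorm)
open ExpKernelCalculus (Site MKer BiLoc comp shiftK Zl)
open DressedMomentNormalisation (resSite)
open AffineAveraging (unitVec)
open VectorTailsLoc (fam kfam)
open PoissonInterior (nrm)
open OneStepResolventKernel (KInv)
open InterLevelTransport (onLat)
open BalabanStepJets (lamCoeffOf)
open AveragingHessianKernels (hessFF)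
open KernelWard (divV)
open Summit.QuantumFields.BalabanUV.Beta.TameKernelCalculus (Spr Loc trK)
open Summit.QuantumFields.BalabanUV.Beta.D1BFx.GluonLeg (Ga)
open Summit.QuantumFields.BalabanUV.Beta.D1BFx.GluonLegTails (spr_Ga_of_prop12)
open Summit.QuantumFields.BalabanUV.Beta.D1BFx.FrozenLegTails (nOf MOf hn1)
open Summit.QuantumFields.BalabanUV.Beta.D1BFx.GhostLeg (Ggh)
open Summit.QuantumFields.BalabanUV.Beta.D1BFx.RProjector (Pgt)
open Summit.QuantumFields.BalabanUV.Beta.D1BFx.RProjectorJet (RG)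
open Summit.QuantumFields.BalabanUV.Beta.D1BFx.ReducedKernel (TableR)
open Summit.QuantumFields.BalabanUV.Beta.D1BFx.FineHessianSectors (slotWt slotTab)
open Summit.QuantumFields.BalabanUV.Beta.D1BFx.DressedTadpoleTable (tadpoleTable)
open Summit.QuantumFields.BalabanUV.Beta.D1BFx.FineStencilBF (ffOf)
open Summit.QuantumFields.BalabanUV.Beta.D1BFx.FineStencilBFBalaban (SbfBal)
open Summit.QuantumFields.BalabanUV.Beta.D1BFx.SectorRecut (SbT)
open Summit.QuantumFields.BalabanUV.Beta.D1BFx.GluonNeedleSplit (dipPiece ndlPiece)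
open Summit.QuantumFields.BalabanUV.Beta.D1BFx.GluonNeedleGlue (cellSum)
open Summit.QuantumFields.BalabanUV.Beta.D1BFx.FrozenLegProfile (gfrz)
open Summit.QuantumFields.BalabanUV.Beta.D1BFx.SplitInstance (RestIdx)
open Summit.QuantumFields.BalabanUV.Beta.D1BFx.SplitRecut (restK')
open Summit.QuantumFields.BalabanUV.Beta.D1BFx.SplitInstanceS (restKS)
open Summit.QuantumFields.BalabanUV.Beta.D1BFx.RankOneBubble (applyK pairing)
open Summit.QuantumFields.BalabanUV.Beta.D1BFx.RankOneBubbleJets (grad)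
open Summit.QuantumFields.BalabanUV.Beta.D1BFx.RoadEndBFxRows (grpRec cgRec localFibre)
open Summit.QuantumFields.BalabanUV.Beta.D1BFx.RoadEndBFxRowsS (hGrp_of_rowsS)
open Summit.QuantumFields.BalabanUV.Beta.D1BFx.LocalGroupRowS (hLoc_of_prop12'S)
open Summit.QuantumFields.BalabanUV.Beta.D1BFx.NeedleRowsAtRayS (abs_weight₄_le_of_rayS abs_weight₅_le_of_rayS abs_weight₆_le_of_rayS h₇_of_rayS)
open Summit.QuantumFields.BalabanUV.Beta.D1BFx.NeedleGhostBubbleRowMass10 (h₄_of_scaling₁₀)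
open Summit.QuantumFields.BalabanUV.Beta.D1BFx.NeedleGhostBubbleRowMass10T5 (h₅_of_scaling₁₀)
open Summit.QuantumFields.BalabanUV.Beta.D1BFx.NeedleGhostBubble2RowMass8 (h₆_of_scaling₈)
open Summit.QuantumFields.BalabanUV.Beta.D1BFx.GhostBubbleTailsII (hGbub_s_of_prop12)
open Summit.QuantumFields.BalabanUV.Beta.D1BFx.GluonNeedleRowsT12 (h₁_of_prop12 h₂_of_prop12')
open Summit.QuantumFields.BalabanUV.Beta.D1BFx.GluonNeedleRowT3 (h₃_of_prop12'')

namespace Summit.QuantumFields.BalabanUV.Beta.D1BFx.RoadEndGroupsS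

variable {a N cgh₀ : ℝ} {μ ν : Fin 4} {cE cVH cΛ cR cK cQ cE₂ cJ4 cΛ₂ cR₂ cQ₂ x₀ ωgl ωgh cgh : ℕ → ℝ} {WE WJ WΛ WR WQ : ℕ → TableR}
  {CE CJ CΛt CRt CQ δW : ℕ → ℝ}
  {TΛ WA : ℕ → Fin 4 → Site 4 → Fin 4 → Site 4 → MKer 4 (Fin 4)} {CT δT : ℕ → ℝ}
  {ε : ℕ → ℝ} {X : ℕ → Site 4 → MKer 4 (Fin 4)} {Cx δx : ℕ → ℝ}

/-- [folklore] **«END-WIRE-S»: THE GROUP HYPOTHESIS `hGrp` OF THE «ENDₛ» END FOR THE LABEL OF RECORD UNDER READING (ii)** — `RoadEndGroups.hGrp_of_prop12'` for the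
two-profile words `restKS (gfrz n a b) (s n • gfrz n a b)` with the loop-weight tie RESCALED (`hωs`, pin `hs : s n = n⁻²`) and, NEW, the ghost sector SUPPLIED: the
three local ghost bubbles «L-GBUB» by gan24-leaf-05-g44's `GhostBubbleTailsII.hGbub_s_of_prop12`, the ghost needle rows T₄∕T₅ by leaf-01-g16's tolerance-`n¹⁰`
rows `NeedleGhostBubbleRowMass10{,T5}.h₄∕h₅_of_scaling₁₀`, T₆ by gan24-leaf-05-g44's `NeedleGhostBubble2RowMass8.h₆_of_scaling₈`, T₇ by leaf-04-g12's
`NeedleGhostTadpoleRowMass8` through `NeedleRowsAtRayS.h₇_of_rayS` — their letters `4N²a·n¹⁰` ∕ `4N²a²·n⁸` ∕ `4N²a·n⁸` being EXACTLY the weight products at the ray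
under the rescaled tie (`NeedleRowsAtRayS`).  Displayed and NOT proved here: the ENDs' common data (`0 < a`, `μ ≠ ν`, the five slot tables bi-localised), the printed
statements [B5, Prop. 1.2] ∧ [B5, (1.126)–(1.127)] BY NAME, the pins `hlam`∕`hcE`∕`hRsgn`∕`hJ4`, the tie `hωs` + `hs`, the ray `hK`∕`hQr`∕`hx` with `|cgh n| ≤ cgh₀` (P13);
(LOCAL) slot-E's support radius ∕ rate floor ∕ scaling letter and slot R's SOCKETS; (Λ) the Λ₂-slot sockets, `cΛ ≠ 0`, `ε = ±1`, `hX`, (W1), (W2′); (N) the slot-4 tadpole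
row `h₈` (T₈: `WQ` awaits (A2)) — THE ONLY REMAINING OPEN REST INPUT.  Conclusion: `hGrp` of `RoadEndBFxTotalShellGroupsS.d1Drift_BFx_total_shell_of_prop12_of_groupsS`
at `grp := grpRec`, `g₀ := 3`, with an EXISTENTIAL constant vector. -/
theorem hGrp_of_prop12S (ha : 0 < a) (hμν : μ ≠ ν)
    (h12 : B5.Prop12Printed (fam nOf hn1 MOf a ha)) (h126 : B5.Kernel126_127Printed (kfam nOf MOf))
    (hlam : ∀ n : ℕ, 2 ≤ n → ωgl n * cE n ^ 2 = 2 * N ^ 2 * (n : ℝ) ^ 8) (hcE : ∀ n : ℕ, 2 ≤ n → cE n = (n : ℝ) ^ 4)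
    (hRsgn : ∀ n : ℕ, 2 ≤ n → cR n = -cE n) (hJ4 : ∀ n : ℕ, cJ4 n = 0)
    -- the RESCALED loop-weight tie (reading (ii)): displayed scalar family `s`, pinned `s n = n⁻²`
    (s : ℕ → ℝ) (hs : ∀ n : ℕ, 2 ≤ n → s n = ((n : ℝ) ^ 2)⁻¹) (hωs : ∀ n : ℕ, 2 ≤ n → ωgh n * (s n * cK n) ^ 2 = -2 * (ωgl n * cE n ^ 2))
    (hcgh : ∀ n : ℕ, |cgh n| ≤ cgh₀) (hK : ∀ n : ℕ, cK n = cgh n * (n : ℝ) ^ 2) (hQr : ∀ n : ℕ, cQ n = cgh n * a) (hx : ∀ n : ℕ, x₀ n = -cgh n)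
    (hδW : ∀ n, 0 < δW n)
    (hE : ∀ n κ u l u', BiLoc (WE n κ u l u') u u' (CE n) (δW n)) (hJ : ∀ n κ u l u', BiLoc (WJ n κ u l u') u u' (CJ n) (δW n))
    (hΛ : ∀ n κ u l u', BiLoc (WΛ n κ u l u') u u' (CΛt n) (δW n)) (hR : ∀ n κ u l u', BiLoc (WR n κ u l u') u u' (CRt n) (δW n))
    (hQ : ∀ n κ u l u', BiLoc (WQ n κ u l u') u u' (CQ n) (δW n))
    -- (LOCAL) slot-E support∕units; slot-R envelope∕units (the three local ghost bubbles are SUPPLIED under reading (ii): `GhostBubbleTailsII.hGbub_s_of_prop12`)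
    {ρE : ℕ} {δ₀ kE : ℝ} (hδ₀ : 0 < δ₀) (hδE : ∀ n, δ₀ ≤ δW n)
    (hsuppE : ∀ n κ u l u', ρE < supNorm (u - u') → WE n κ u l u' = 0)
    (hkE : ∀ n : ℕ, 2 ≤ n → |ωgl n * cE₂ n| * CE n ≤ kE * (n : ℝ) ^ 8)
    {CwR δR : ℕ → ℝ} {θR δ₀R kR : ℝ} (hθR : 0 < θR) (hδR : ∀ n, 0 < δR n) (hδ₀R : 0 < δ₀R) (hδRge : ∀ n : ℕ, δ₀R / n ≤ δR n) (hCwR : ∀ n, 0 ≤ CwR n)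
    (hWR : ∀ n κ u l u', BiLoc (WR n κ u l u') u u' (CwR n * Real.exp (-(θR / n) * supNorm (u - u'))) (δR n))
    (hkR : ∀ n : ℕ, 2 ≤ n → |ωgl n * cR₂ n| * CwR n * (n : ℝ) ^ 6 ≤ kR)
    -- (Λ) sockets and zero-momentum data
    (hδT : ∀ n, 0 < δT n)
    (hdec : ∀ n : ℕ, 2 ≤ n → ∀ [NeZero n], ∀ κ u l u', WΛ n κ u l u' =
      (∑ m : Fin 4, OneStepResolventKernel.wsum (onLat n (fun y => lamCoeffOf (KInv (N := n) (d := 3)) n m y l u'))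
          (fun v => onLat n (fun y => TΛ n m y κ u) v))
      + (∑ m : Fin 4, OneStepResolventKernel.wsum (onLat n (fun y => lamCoeffOf (KInv (N := n) (d := 3)) n m y κ u))
          (fun v => onLat n (fun y => TΛ n m y l u') v))
      + WA n κ u l u')
    (hTloc : ∀ (n : ℕ) m y κ u, BiLoc (TΛ n m y κ u) ((n : ℤ) • y) ((n : ℤ) • y) (CT n * Real.exp (-δT n * l1 ((n : ℤ) • y - u))) (δT n))
    (hWAa : ∀ n κ u l u', trK (WA n κ u l u') = -WA n κ u l u') (hWAl : ∀ n κ u l u', Loc (WA n κ u l u'))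
    (hTcov : ∀ (n : ℕ) m y κ u t, TΛ n m (y + t) κ (u + (n : ℤ) • t) = shiftK (-((n : ℤ) • t)) (TΛ n m y κ u))
    (hcΛ : ∀ n : ℕ, 2 ≤ n → cΛ n ≠ 0) (hε : ∀ n : ℕ, ε n = 1 ∨ ε n = -1) (hδx : ∀ n, 0 < δx n) (hX : ∀ n u, BiLoc (X n u) u u (Cx n) (δx n))
    (hW1 : ∀ n : ℕ, 2 ≤ n → ∀ [NeZero n], ∀ u,
      comp (comp (Ga n a) (divV (fun κ v => ε n • SbfBal n a (cE n) (cVH n) (cΛ n) (cR n) (cK n) (cQ n) κ v) u)) (Ga n a) =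
        comp (Ga n a) (X n u) - comp (X n u) (Ga n a))
    (hW2 : ∀ n : ℕ, 2 ≤ n → ∀ [NeZero n], ∀ (m : Fin 4) (u : Site 4),
      divV (fun κ v => (-(ε n * (cΛ₂ n / cΛ n))) • TΛ n m 0 κ v) u = comp (X n u) (ffOf (hessFF n m 0)) - comp (ffOf (hessFF n m 0)) (X n u))
    -- (N) the slot-4 tadpole row
    {C₈ : ℝ}
    (h₈ : ∀ n : ℕ, 2 ≤ n → ∀ [NeZero n], |ωgl n * cQ₂ n * ∑ b ∈ (univ : Finset (Fin 4 → Fin n)).image resSite, ((n : ℝ) ^ 4)⁻¹ * (((n : ℝ) ^ 8)⁻¹ *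
      fullSum (fun w : Pt => toReal w μ * toReal w ν * tadpoleTable n a (WQ n) μ ν (b + w) b))| ≤ C₈) :
    ∃ CGv : Fin 4 → ℝ, ∀ n : ℕ, 2 ≤ n → ∀ [NeZero n], ∀ g : Fin 4, g ≠ 3 →
      |∑ b ∈ (univ : Finset (Fin 4 → Fin n)).image resSite, ((n : ℝ) ^ 4)⁻¹ *
        fullSum (fun w : Pt => ∑ τ ∈ (univ : Finset RestIdx).filter (fun τ => grpRec τ = g),
          restKS n a (gfrz n a b) (fun v => s n * gfrz n a b v) (cE n) (cΛ n) (cR n) (cK n) (cQ n) (cE₂ n) (cJ4 n) (cΛ₂ n) (cR₂ n) (cQ₂ n) (x₀ n)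
            (WE n) (WJ n) (WΛ n) (WR n) (WQ n) (ωgl n) (ωgh n) ((n : ℝ) ^ 8) N μ ν b τ w)| ≤ CGv g := by
  have hGa : ∀ n : ℕ, 2 ≤ n → ∀ [NeZero n], Spr (Ga n a) := fun n _ _ => spr_Ga_of_prop12 (a := a) (ha := ha) h12 h126 n
  -- (LOCAL): slots E and R in the `slotTab`∕`slotWt` currency of `LocalGroupRow` (defeq)
  have hWE : ∀ n κ u l u', BiLoc (slotTab (WE n) (WJ n) (WΛ n) (WR n) (WQ n) 0 κ u l u') u u' (CE n) (δW n) := fun n κ u l u' => hE n κ u l u'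
  have hsuppE' : ∀ n κ u l u', ρE < supNorm (u - u') → slotTab (WE n) (WJ n) (WΛ n) (WR n) (WQ n) 0 κ u l u' = 0 :=
    fun n κ u l u' h => hsuppE n κ u l u' h
  have hkE' : ∀ n : ℕ, 2 ≤ n → |ωgl n * slotWt (cE₂ n) (cJ4 n) (cΛ₂ n) (cR₂ n) (cQ₂ n) 0| * CE n ≤ kE * (n : ℝ) ^ 8 := fun n hn => hkE n hn
  have hWR' : ∀ n κ u l u', BiLoc (slotTab (WE n) (WJ n) (WΛ n) (WR n) (WQ n) 3 κ u l u') u u' (CwR n * Real.exp (-(θR / n) * supNorm (u - u'))) (δR n) :=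
    fun n κ u l u' => hWR n κ u l u'
  have hkR' : ∀ n : ℕ, 2 ≤ n → |ωgl n * slotWt (cE₂ n) (cJ4 n) (cΛ₂ n) (cR₂ n) (cQ₂ n) 3| * CwR n * (n : ℝ) ^ 6 ≤ kR := fun n hn => hkR n hn
  -- «L-GBUB» under reading (ii): gan24-leaf-05-g44's row at the second profile, one constant per `(r, r') ≠ (0, 0)`
  classical
  have hGs := fun (r r' : Fin 2) (hrr : ¬(r = 0 ∧ r' = 0)) => hGbub_s_of_prop12 (cΛ := cΛ) (cR := cR) (cQ := cQ) (cE₂ := cE₂) (cJ4 := cJ4) (cΛ₂ := cΛ₂)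
    (cR₂ := cR₂) (cQ₂ := cQ₂) (x₀ := x₀) (WE := WE) (WJ := WJ) (WΛ := WΛ) (WR := WR) (WQ := WQ) (N := N) (μ := μ) (ν := ν) ha h12 h126 hlam s hs hωs r r' hrr
  let CG : Fin 2 → Fin 2 → ℝ := fun r r' => if hrr : ¬(r = 0 ∧ r' = 0) then Classical.choose (hGs r r' hrr) else 0
  have hGbub : ∀ (r r' : Fin 2), ¬(r = 0 ∧ r' = 0) → ∀ n : ℕ, 2 ≤ n → ∀ [NeZero n],
      |∑ b ∈ (univ : Finset (Fin 4 → Fin n)).image resSite, ((n : ℝ) ^ 4)⁻¹ *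
        fullSum (fun w : Pt => restK' n a (fun v => s n * gfrz n a b v) (cE n) (cΛ n) (cR n) (cK n) (cQ n) (cE₂ n) (cJ4 n) (cΛ₂ n) (cR₂ n) (cQ₂ n) (x₀ n)
          (WE n) (WJ n) (WΛ n) (WR n) (WQ n) (ωgl n) (ωgh n) ((n : ℝ) ^ 8) N μ ν b
            (Sum.inr (Sum.inr (Sum.inr (Sum.inl ((0 : Fin 2), (0 : Fin 2), r, r'))))) w)| ≤ CG r r' := by
    intro r r' hrr n hn _
    have e : CG r r' = Classical.choose (hGs r r' hrr) := dif_pos hrr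
    rw [e]
    exact (Classical.choose_spec (hGs r r' hrr)).2 n hn
  obtain ⟨CL, hLoc⟩ := hLoc_of_prop12'S (N := N) (cΛ := cΛ) (cR := cR) (cK := cK) (cQ := cQ) (cΛ₂ := cΛ₂) (cR₂ := cR₂) (cQ₂ := cQ₂) (x₀ := x₀) (ωgh := ωgh)
    (s := s) (WJ := WJ) (WΛ := WΛ) (WR := WR) (WQ := WQ) (μ := μ) (ν := ν) ha h12 h126 hlam hJ4 hδ₀ hδE hWE hsuppE' hkE' hθR hδR hδ₀R hδRge hCwR hWR' hkR'
    hGbub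
  -- (N): the gluon rows are the record's; the ghost rows are the TOLERANCE rows of reading (ii) with their letters at the ray under the rescaled tie
  obtain ⟨C₁, _, h₁⟩ := h₁_of_prop12 (N := N) (cE := cE) (cR := cR) (cK := cK) (cQ := cQ) (ωgl := ωgl) ha h12 h126 hlam hcE hRsgn hcgh hK hQr μ ν
  obtain ⟨C₂, _, h₂⟩ := h₂_of_prop12' (N := N) (cE := cE) (cR := cR) (cK := cK) (cQ := cQ) (ωgl := ωgl) ha h12 h126 hlam hcE hRsgn hcgh hK hQr μ ν
  obtain ⟨C₃, _, h₃⟩ := h₃_of_prop12'' (N := N) (cE := cE) (cR := cR) (cK := cK) (cQ := cQ) (ωgl := ωgl) ha h12 h126 hlam hcE hRsgn hcgh hK hQr μ ν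
  have h₄ := h₄_of_scaling₁₀ ha (abs_weight₄_le_of_rayS (ωgh := ωgh) ha.le hωs hs hlam hK hQr) μ ν
  have h₅ := h₅_of_scaling₁₀ ha (abs_weight₅_le_of_rayS (ωgh := ωgh) ha.le hωs hs hlam hK hQr) μ ν
  have h₆ := h₆_of_scaling₈ ha (abs_weight₆_le_of_rayS (ωgh := ωgh) hωs hs hlam hK hQr) μ ν
  have h₇ := h₇_of_rayS (ωgh := ωgh) ha hωs hs hlam hK hQr hx μ ν
  exact ⟨_, hGrp_of_rowsS ha hμν hGa hδW hE hJ hΛ hR hQ s hLoc hδT hdec hTloc hWAa hWAl hTcov hcΛ hε hδx hX hW1 hW2 h₁ h₂ h₃ h₄ h₅ h₆ h₇ h₈⟩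

end Summit.QuantumFields.BalabanUV.Beta.D1BFx.RoadEndGroupsS

end
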